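import Summits.BirchSwinnertonDyer.Rank1Residual.Additive.TypeGThree
import Summits.BirchSwinnertonDyer.Rank1Residual.AdditivePotMult.TwistSupply
import Literature.NumberTheory.EllipticCurves.Delbourgo2002.PAdicBSDLeadingTerm
import Literature.NumberTheory.EllipticCurves.SelmerInftyTorsionFiniteProofs
import HarnessLib

/-!
# (G)-ordinary at `p = 3` and Delbourgo 2002: the BRIDGE from the sub-cell predicate `TypeGOrd W 3`
# to the named fact `Delbourgo2002.mainTheorem_three`, and the exact rank-`0` leading term with its
# factor `ℓ ∣ 9` (cell `b2b-bsdres`, team n1011, seat p16, sub-target T-N10M — `p = 3` extension)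

HONEST FRAMING (cell `b2b-bsdres`, run/shared/lean/b2b/bsd-rank1-residual/, verbatim in every
file): the goal of the cell is to DELETE the COMBINATION-SHAPED residual classes of the
Birch–Swinnerton-Dyer formula for ALL analytic-rank `≤ 1` elliptic curves over `ℚ` — "full BSD
formula for every rank `≤ 1` curve in class `C`" assembled STRICTLY from published theorems — so
that the rank-`≤ 1` remainder becomes exactly the CONSTRUCTION-SHAPED classes, which are TYPED
(missing-input `Prop`s), NOT attempted. This is not "finishing BSD". Team n1011 (N10 / N11):
research route; prove what is provable now; no claim beyond the stated classes; X3♯(G-ord) /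
X4♯(G-ord) stay CONSTRUCTION-SHAPED; labels UNCHANGED; nothing booked. Theorems only (no definition,
no named fact minted here; the one Literature input is the explicit binder `hDel3`).

## What and why

D. Delbourgo, J. Number Theory 95 (2002), Main Theorem (A)+(B) is typed in the tree in three cases:
`Delbourgo2002.mainTheorem` (A175: potentially good ordinary, `p ≥ 5`), `mainTheorem_potMult` (A190:
`ord_p j < 0`, every odd `p`) and `mainTheorem_three` (this seat: `p = 3`, potentially good ORDINARY,
with the printed clause "semistable reduction over a quadratic extension of `ℚ₃`" as the binder
"some quadratic twist has a globally minimal model with good ordinary reduction at `3`"). The N11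
block's (G-ord)@3 share (16 517 S-b rank-`0` pairs, RESIDUAL-MAP §I N11) and the (G-ord)@3 part of
O7-ord sit exactly there. This file is the kernel BRIDGE from the cell's predicate to the `p = 3` fact:

* `TypeGOrd.exists_goodOrd_twist_model_three`: on `TypeGOrd W 3 ∧ Addv W 3` the twist `E^{(−3)}`
  has a globally minimal model with good ordinary reduction at `3` (additive-p2
  `goodOrd_twist_three_of_typeGOrd` + additive-p1 `exists_globallyMinimal_model_twist`) — the
  Hypothesis' second bullet, discharged.
* `TypeGOrd.delbourgo2002_three` (THE bridge; `¬ W.HasCM` stays an explicit binder — CM curves do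
  occur on this locus), `TypeGOrd.isTorsion_three_of_delbourgo2002` ((A)),
  `TypeGOrd.constantCoeff_three_of_delbourgo2002` ((B) at `r_E = 0`: `fE(0) · #E(ℚ)_{tors}² = u · ℓ · #Ш[3^∞] · ∏ c_ℓ`,
  `ℓ ∣ 9`, `ℓ = 1` off the anomalous rows — the proviso is LIVE here, unlike on (M)), class wrappers
  `ClassX4Gord.delbourgo2002_three`, `ClassX3Gord.delbourgo2002_three`.

Consumers (other seats, by the team's one-owner rule): the rank-`0` Miller-currency reduction over the
shared typed input `Additive.CycLowerLeadingTermAt` (n1011-p18; at `p ≥ 5` additive-p2's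
`GordCharLeadingTerm`), and the rank-`1` strand (n1011-p01, `CycLowerBoundAt`). What this file does NOT
do: it proves no lower bound for any curve, books nothing and changes no label.

References: D. Delbourgo, J. Number Theory 95 (2002) 38–71, Hypothesis (p. 39), Theorem (A), (B)
(p. 40), Remark after Lemma 2.1 (p. 53), p. 61, pp. 69–70 [Delbourgo2002]; J. H. Silverman, *AEC*
VIII.8 (global minimal models) [SilvermanAEC2009].
-/

noncomputable section

open scoped Classical NumberField

open WeierstrassCurve NumberField IsDedekindDomain
  Literature.NumberTheory.EllipticCurves
  Literature.NumberTheory.EllipticCurves.Rank1Residual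

namespace Summit.BirchSwinnertonDyer.Rank1Residual.Additive

open AdditivePotMult

variable {W : WeierstrassCurve ℚ} [W.IsElliptic] [W.IsGloballyMinimal]

/-- **On the (G)-ordinary locus at `3`, Delbourgo's quadratic-semistability clause holds in the typed
form**: the twist `E^{(−3)}` has a globally minimal model with GOOD ORDINARY reduction at `3`
(additive-p2's `goodOrd_twist_three_of_typeGOrd` + a global minimal model of the twist).
[cite: Delbourgo2002, Hypothesis (p. 39), second bullet] -/
theorem TypeGOrd.exists_goodOrd_twist_model_three (hG : TypeGOrd W 3) (hadd : Addv W 3) :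
    ∃ (d : ℚ) (V : WeierstrassCurve ℚ) (_ : V.IsElliptic) (_ : V.IsGloballyMinimal)
      (C : VariableChange ℚ), d ≠ 0 ∧ C • W.quadraticTwist d = V ∧
      V.HasGoodReductionAtPrime 3 ∧ ¬ (3 : ℤ) ∣ V.frobeniusTrace 3 := by
  have hd : ((-1 : ℚ) ^ ((3 : ℕ) / 2) * (3 : ℕ)) ≠ 0 := by norm_num
  obtain ⟨V, iV, iVm, C, hC⟩ := exists_globallyMinimal_model_twist W hd
  have hgo : GoodOrd V 3 := goodOrd_twist_three_of_typeGOrd W hG hadd V ⟨C, hC⟩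
  exact ⟨_, V, iV, iVm, C, hd, hC, hgo.1, hgo.2⟩

/-- **The bridge (G-ord)@3 ⟶ Delbourgo 2002 at `p = 3`.** For `W` globally minimal, non-CM, additive
and (G)-ordinary at `3` (`TypeGOrd W 3`), the named fact `Delbourgo2002.mainTheorem_three` applies
with its Hypothesis binders discharged in the kernel ((G) global form = `TypeGOrd`; the good ordinary
twist from `TypeGOrd.exists_goodOrd_twist_model_three`). Output: (A) + (B) as
`LeadingTermClauses W 3 Dh` (ANY rank; the factor `ℓ ∣ 9` with `ℓ = 1` off the anomalous rows stays).
`¬ W.HasCM` is a genuine binder here (CM curves do occur on the (G-ord) locus at `3`).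
[cite: Delbourgo2002, Theorem (A), (B) (p. 40), Hypothesis (p. 39)] -/
theorem TypeGOrd.delbourgo2002_three [Fact (Nat.Prime 3)]
    (hDel3 : Delbourgo2002.mainTheorem_three) (hG : TypeGOrd W 3) (hadd : Addv W 3)
    (hcm : ¬ W.HasCM) :
    (∀ (κ : ZpExtension ℚ 3) (γ : Field.absoluteGaloisGroup ℚ),
        κ.IsCyclotomic → κ.IsTopGenerator γ → ∀ D : W.SelmerDualData κ γ, D.IsTorsion) ∧
    ∃ Dh : PAdicHeightData W 3, Delbourgo2002.LeadingTermClauses W 3 Dh :=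
  hDel3 W 3 rfl hcm hadd hG (hG.exists_goodOrd_twist_model_three hadd)

/-- (A) on (G-ord)@3: `X(E/ℚ_∞)` is `Λ`-torsion. [cite: Delbourgo2002, Theorem (A) (p. 40)] -/
theorem TypeGOrd.isTorsion_three_of_delbourgo2002 [Fact (Nat.Prime 3)]
    (hDel3 : Delbourgo2002.mainTheorem_three) (hG : TypeGOrd W 3) (hadd : Addv W 3)
    (hcm : ¬ W.HasCM)
    {κ : ZpExtension ℚ 3} {γ : Field.absoluteGaloisGroup ℚ} (hκ : κ.IsCyclotomic)
    (hγ : κ.IsTopGenerator γ) (D : W.SelmerDualData κ γ) : D.IsTorsion :=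
  (hG.delbourgo2002_three hDel3 hadd hcm).1 κ γ hκ hγ D

/-- **Rank `0` on (G-ord)@3: the exact algebraic leading term with Delbourgo's factor `ℓ`.** For `W`
globally minimal, non-CM, additive and (G)-ordinary at `3`, `E(ℚ)` finite, `Ш(E/ℚ)[3^∞]` finite: for
the cyclotomic `κ, γ` (cyclotomic variable), every dual datum `D` and generator `fE` of `char_Λ X`,
`ord_{T=0} fE = 0` and `fE(0) · #E(ℚ)_{tors}² = u · ℓ · #Ш[3^∞] · ∏ c_ℓ` with `u ∈ ℤ₃^×`, `ℓ ∣ 9` and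
`ℓ = 1` off the anomalous rows (`Delbourgo2002.ReductionNonAnomalous W 3` — LIVE here, unlike on
(M)). This is the slot a rank-`0` (G-ord)@3 lower-half consumer starts from (additive-p2's
`exists_padicVal_shaAn_of_constantCoeff_eq` at `p ≥ 5`; n1011-p18's over the shared typed input).
[cite: Delbourgo2002, Theorem (B) (p. 40), ℓ_p(E) (p. 39)] -/
theorem TypeGOrd.constantCoeff_three_of_delbourgo2002 [Fact (Nat.Prime 3)]
    (hDel3 : Delbourgo2002.mainTheorem_three) (hG : TypeGOrd W 3) (hadd : Addv W 3)
    (hcm : ¬ W.HasCM)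
    [Finite W.toAffine.Point] (hfin : Finite (AddCommGroup.primaryComponent W.sha 3))
    {κ : ZpExtension ℚ 3} {γ : Field.absoluteGaloisGroup ℚ} (hκ : κ.IsCyclotomic)
    (hγ : κ.IsTopGenerator γ) (hγ' : IsCyclotomicVariable 3 γ) (D : W.SelmerDualData κ γ)
    {fE : IwasawaAlgebra 3} (hf : D.charIdeal = Ideal.span {fE}) :
    fE.order = 0 ∧ ∃ (u : ℤ_[3]ˣ) (ℓ : ℕ), ℓ ∣ 3 ^ 2 ∧
      (Delbourgo2002.ReductionNonAnomalous W 3 → ℓ = 1) ∧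
      ((PowerSeries.constantCoeff fE : ℤ_[3]) : ℚ_[3]) * (W.torsionOrder : ℚ_[3]) ^ 2 =
        ((u : ℤ_[3]) : ℚ_[3]) * (ℓ : ℚ_[3]) *
          ((Nat.card (AddCommGroup.primaryComponent W.sha 3) : ℚ_[3]) * W.tamagawaProduct) := by
  haveI : Module.Finite (IwasawaAlgebra 3) D.X :=
    SelmerDualData.module_finite_of_isCyclotomic (W := W) (κ := κ) hκ D hγ
  obtain ⟨hA, Dh, hB⟩ := hG.delbourgo2002_three hDel3 hadd hcm
  exact hB.constantCoeff hκ hγ hγ' D (hA κ γ hκ hγ D) hf hfin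

/-- **X4♯(G-ord)@3 bridge** (with the non-CM binder explicit).
[cite: Delbourgo2002, Theorem (A), (B) (p. 40)] -/
theorem ClassX4Gord.delbourgo2002_three [Fact (Nat.Prime 3)]
    (hDel3 : Delbourgo2002.mainTheorem_three) (hX : ClassX4Gord W 3) (hcm : ¬ W.HasCM) :
    (∀ (κ : ZpExtension ℚ 3) (γ : Field.absoluteGaloisGroup ℚ),
        κ.IsCyclotomic → κ.IsTopGenerator γ → ∀ D : W.SelmerDualData κ γ, D.IsTorsion) ∧
    ∃ Dh : PAdicHeightData W 3, Delbourgo2002.LeadingTermClauses W 3 Dh :=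
  hX.typeGOrd.delbourgo2002_three hDel3 hX.addv.2 hcm

/-- **X3♯(G-ord)@3 bridge** (reducible `E[3]` allowed: the source has no image hypothesis).
[cite: Delbourgo2002, Theorem (A), (B) (p. 40)] -/
theorem ClassX3Gord.delbourgo2002_three [Fact (Nat.Prime 3)]
    (hDel3 : Delbourgo2002.mainTheorem_three) (hX : ClassX3Gord W 3) (hcm : ¬ W.HasCM) :
    (∀ (κ : ZpExtension ℚ 3) (γ : Field.absoluteGaloisGroup ℚ),
        κ.IsCyclotomic → κ.IsTopGenerator γ → ∀ D : W.SelmerDualData κ γ, D.IsTorsion) ∧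
    ∃ Dh : PAdicHeightData W 3, Delbourgo2002.LeadingTermClauses W 3 Dh :=
  hX.typeGOrd.delbourgo2002_three hDel3 hX.addv hcm

end Summit.BirchSwinnertonDyer.Rank1Residual.Additive

end
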